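import Summits.CriticalPhenomena.PercolationContinuityZ3.Theorems.Transplant.SkelPhiParaRouteSetsCW
import HarnessLib

/-!
# N1 (the `{±1}` node), (C) column file (C-S8): THE CORRIDOR RECORD VALUES UNDER RULING B.15 (S1) AND THEIR JOINS — the closed forms of the three
# records of the one-frame corridor `reachOblRHN_negSG₂b_of_inputs` in the long data `(n, ℓ, h, v)`, the kit slack `T` (= the schedule's `R′`,
# the records' `e = ea = eb`) and the arrival half-widths `aW, bL` (the frame change of the arrival box `cen ± b₀`):
# segment A (signed v-rounds, axis `1`) `vLocPrmD n ℓ h v T W_A L0_A N_A`, segment B (u-rounds, axis `0`) `xLocPrm n ℓ h T W_B L0_B N_B`, the band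
# `bandNw n ℓ h v T n 799 q_y 799 q_y Wmy Wpy du` (windowed, (C-N9w)/(C-S3w)), with
# `W_A := max n ⌈aW⌉`, `L0_A := ⌈bL⌉`, `N_A := L0_A / (sA − T)`, `W_B := ⌊nℓ/U⌋ + 1`, `L0_B := W_A + (N_A+1)(T + |v|)`, `N_B := L0_B / (n − T)`,
# `q_x := n`, `q_y := W_B + (N_B+1)T` (also the x-band's window), `Wmy := n + v⁺`, `Wpy := n + v⁻`, `N_C := 799` (800 strides = one cell);
# and the three JOIN inclusions `hjoinA` (last core of A ⊆ first core of B), `hjoin` (last core of B ⊆ first core of the band), `hreg` (first core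
# of the band ⊆ last region of B) under the two floors `T + 1 ≤ sA` and `T + 1 ≤ n` (the rounds contract by whole strides: `LocPrm.L_le_of_rounds`).

builds on p205010 (kernel theorem, internal audit signed; external expert review pending) — nothing in this file uses p205010; nothing here is a
claim about the open node `SamePDropOfSkeletonNeg`.
Lane `prim-bschramm`, seat `prim-bschramm-p5` (gen 9; (C) lineage); helper file (`--supports stmt-CriticalPhenomena-4575`).
[cite: KozmaNitzan2024, §4 Lemma 12 (pp. 23–25: the rounds into the target box, the corridor run)] [cite: MartineauTassion2017, §4.3 Lemma 4.2]
-/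

noncomputable section

namespace Summit.CriticalPhenomena.PercolationContinuityZ3.Theorems.Transplant

namespace Skelφ

namespace CorrRec

open Literature.Probability.Percolation Literature.Probability.LatticeModels
open Literature.Probability.Percolation.KozmaNitzan.Cells (oth sgOf sgOf_sign)
open ChainPlanar ChainPara

/-- `oth 0 = 1` on `Fin 2`. [folklore] -/
private theorem oth_zero' : oth (0 : Fin 2) = 1 := by decide

/-- `oth 1 = 0` on `Fin 2`. [folklore] -/
private theorem oth_one' : oth (1 : Fin 2) = 0 := by decide

/-! ## §1 The closed forms -/

section Defs

variable (n ℓ : ℕ) (h v : ℤ) (T : ℕ) (aW bL : ℤ)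

/-- The window unit `⌊nℓ/U⌋ + 1` (one v-stride read along `⌊β′/U⌋`; the u-stride's landing piece): `W_B`. [this work] -/
def Qw : ℕ := n * ℓ / shearUnit n h + 1

/-- The minimal floored along-progress of a v-stride `⌊(nℓ − U + 1)/U⌋ − 1` (= `(vLocPrmD …).sLo`). [this work] -/
def sA : ℤ := ((n : ℤ) * ℓ - (shearUnit n h : ℕ) + 1) / (shearUnit n h : ℕ) - 1

/-- `W_A := max n ⌈aW⌉`: the v-rounds' transverse window holds the arrival box and both drifted pieces. [this work] -/
def WA : ℕ := max n aW.toNat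

/-- `L0_A := ⌈bL⌉`: the v-rounds' start half-width holds the arrival box. [this work] -/
def L0A : ℕ := bL.toNat

/-- `N_A := L0_A / (sA − T)`: enough v-rounds to contract to one stride. [this work] -/
def NA : ℕ := L0A bL / (sA n ℓ h - T).toNat

/-- `L0_B := W_A + (N_A + 1)(T + |v|)`: the u-rounds' start half-width = the v-rounds' last transverse half-width. [this work] -/
def L0B : ℕ := WA n aW + (NA n ℓ h T bL + 1) * (T + v.natAbs)

/-- `N_B := L0_B / (n − T)`: enough u-rounds to contract to one stride. [this work] -/
def NB : ℕ := L0B n ℓ h v T aW bL / (n - T)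

/-- `q_y := W_B + (N_B + 1)·T`: the u-rounds' last transverse half-width = the y′-band's start half-length = the x-band's window. [this work] -/
def qy : ℕ := Qw n ℓ h + (NB n ℓ h v T aW bL + 1) * T

/-- `Wmy := n + v⁺`: the y′-band's lower window. [this work] -/
def Wmy : ℕ := n + v.toNat

/-- `Wpy := n + v⁻`: the y′-band's upper window. [this work] -/
def Wpy : ℕ := n + (-v).toNat

/-- `N_C := 799`: the band makes `800` strides (one cell). [this work] -/
def NC : ℕ := 799

end Defs

/-! ## §2 Elementary facts of the closed forms -/

section Facts

variable {n ℓ : ℕ} {h v : ℤ} {T : ℕ} {aW bL : ℤ}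

/-- `n ≤ W_A`. [folklore] -/
theorem n_le_WA (n : ℕ) (aW : ℤ) : n ≤ WA n aW := le_max_left _ _

/-- `aW ≤ W_A`. [folklore] -/
theorem aW_le_WA (n : ℕ) (aW : ℤ) : aW ≤ (WA n aW : ℤ) :=
  (Int.self_le_toNat aW).trans (by exact_mod_cast le_max_right _ _)

/-- `bL ≤ L0_A`. [folklore] -/
theorem bL_le_L0A (bL : ℤ) : bL ≤ (L0A bL : ℤ) := Int.self_le_toNat bL

/-- `W_B ≤ q_y`. [folklore] -/
theorem Qw_le_qy (n ℓ : ℕ) (h v : ℤ) (T : ℕ) (aW bL : ℤ) : Qw n ℓ h ≤ qy n ℓ h v T aW bL := Nat.le_add_right _ _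

/-- The lower drifted piece fits: `n + v ≤ Wmy`. [folklore] -/
theorem Wmy_ge (n : ℕ) (v : ℤ) : (n + v).toNat ≤ Wmy n v := by unfold Wmy; omega

/-- The upper drifted piece fits: `n − v ≤ Wpy`. [folklore] -/
theorem Wpy_ge (n : ℕ) (v : ℤ) : (n - v).toNat ≤ Wpy n v := by unfold Wpy; omega

/-- `n ≤ Wmy`, `n ≤ Wpy`. [folklore] -/
theorem n_le_Wy (n : ℕ) (v : ℤ) : n ≤ Wmy n v ∧ n ≤ Wpy n v := ⟨Nat.le_add_right _ _, Nat.le_add_right _ _⟩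

/-- **Enough v-rounds**: `L0_A < (N_A + 1)·(sA − T)` (`T + 1 ≤ sA`). [folklore] -/
theorem L0A_lt (hsT : (T : ℤ) + 1 ≤ sA n ℓ h) (bL : ℤ) : (L0A bL : ℤ) < ((NA n ℓ h T bL : ℕ) + 1) * (sA n ℓ h - T) := by
  have hd : 0 < (sA n ℓ h - T).toNat := by omega
  have h1 := Nat.lt_div_mul_add (a := L0A bL) hd
  have hc : (((sA n ℓ h - T).toNat : ℕ) : ℤ) = sA n ℓ h - T := Int.toNat_of_nonneg (by omega)
  have h2 : ((L0A bL : ℕ) : ℤ) < ((L0A bL / (sA n ℓ h - T).toNat * (sA n ℓ h - T).toNat + (sA n ℓ h - T).toNat : ℕ) : ℤ) := by exact_mod_cast h1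
  push_cast at h2; rw [hc] at h2
  unfold NA; push_cast; rw [hc]; linarith

/-- **Enough u-rounds**: `L0_B < (N_B + 1)·(n − T)` (`T + 1 ≤ n`). [folklore] -/
theorem L0B_lt (hT : T + 1 ≤ n) : L0B n ℓ h v T aW bL < (NB n ℓ h v T aW bL + 1) * (n - T) := by
  have hd : 0 < n - T := by omega
  have h1 := Nat.lt_div_mul_add (a := L0B n ℓ h v T aW bL) hd
  unfold NB; rw [Nat.succ_mul]; exact h1

/-- **The v-rounds contract to one stride**: `L_A(N_A + 1) ≤ W_B` (as integers, `W_B = ⌊nℓ/U⌋ + 1 = sHi_A`). [cite: KozmaNitzan2024, §4 Lemma 12] -/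
theorem LA_last_le (hPA : LocOKD (vLocPrmD n ℓ h v T (WA n aW) (L0A bL) (NA n ℓ h T bL))) (hsT : (T : ℤ) + 1 ≤ sA n ℓ h) :
    (vLocPrmD n ℓ h v T (WA n aW) (L0A bL) (NA n ℓ h T bL)).toLoc.L (NA n ℓ h T bL + 1) ≤ (Qw n ℓ h : ℤ) := by
  have h1 := LocPrm.L_le_of_rounds (LocPrmD.toLoc_ok hPA) (NA n ℓ h T bL + 1)
  have hL0 : ((vLocPrmD n ℓ h v T (WA n aW) (L0A bL) (NA n ℓ h T bL)).toLoc.L0 : ℤ) = (L0A bL : ℕ) := rfl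
  have hs : (vLocPrmD n ℓ h v T (WA n aW) (L0A bL) (NA n ℓ h T bL)).toLoc.sLo = sA n ℓ h := rfl
  have he : ((vLocPrmD n ℓ h v T (WA n aW) (L0A bL) (NA n ℓ h T bL)).toLoc.e : ℤ) = T := rfl
  have hS : (vLocPrmD n ℓ h v T (WA n aW) (L0A bL) (NA n ℓ h T bL)).toLoc.sHi = (n : ℤ) * ℓ / (shearUnit n h : ℕ) + 1 := rfl
  rw [hL0, hs, he, hS] at h1
  have h2 := L0A_lt hsT bL
  have hQ : ((Qw n ℓ h : ℕ) : ℤ) = (n : ℤ) * ℓ / (shearUnit n h : ℕ) + 1 := by unfold Qw; push_cast; rfl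
  rw [hQ]
  refine h1.trans (max_le ?_ le_rfl)
  have h0 : (0 : ℤ) ≤ (n : ℤ) * ℓ / (shearUnit n h : ℕ) := Int.ediv_nonneg (by positivity) (by positivity)
  push_cast at h2 ⊢
  linarith

/-- **The u-rounds contract to one stride**: `L_B(N_B + 1) ≤ n`. [cite: KozmaNitzan2024, §4 Lemma 12] -/
theorem LB_last_le (hPB : LocOK (xLocPrm n ℓ h T (Qw n ℓ h) (L0B n ℓ h v T aW bL) (NB n ℓ h v T aW bL))) (hT : T + 1 ≤ n) :
    (xLocPrm n ℓ h T (Qw n ℓ h) (L0B n ℓ h v T aW bL) (NB n ℓ h v T aW bL)).L (NB n ℓ h v T aW bL + 1) ≤ (n : ℤ) := by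
  have h1 := LocPrm.L_le_of_rounds hPB (NB n ℓ h v T aW bL + 1)
  have hL0 : ((xLocPrm n ℓ h T (Qw n ℓ h) (L0B n ℓ h v T aW bL) (NB n ℓ h v T aW bL)).L0 : ℤ) = (L0B n ℓ h v T aW bL : ℕ) := rfl
  have hs : (xLocPrm n ℓ h T (Qw n ℓ h) (L0B n ℓ h v T aW bL) (NB n ℓ h v T aW bL)).sLo = n := rfl
  have he : ((xLocPrm n ℓ h T (Qw n ℓ h) (L0B n ℓ h v T aW bL) (NB n ℓ h v T aW bL)).e : ℤ) = T := rfl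
  have hS : (xLocPrm n ℓ h T (Qw n ℓ h) (L0B n ℓ h v T aW bL) (NB n ℓ h v T aW bL)).sHi = n := rfl
  rw [hL0, hs, he, hS] at h1
  have h2 := L0B_lt (ℓ := ℓ) (h := h) (v := v) (aW := aW) (bL := bL) hT
  have h3 : ((L0B n ℓ h v T aW bL : ℕ) : ℤ) < ((NB n ℓ h v T aW bL : ℕ) + 1 : ℤ) * ((n : ℤ) - T) := by
    have hTn : T ≤ n := by omega
    have := h2; zify [hTn] at this; exact this
  refine h1.trans (max_le ?_ le_rfl)
  have h0 : (0 : ℤ) ≤ n := by positivity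
  push_cast at h3 ⊢
  linarith

/-- **Every core of the u-rounds is at least one stride long**: `n ≤ L_B(k)` (`L0_B ≥ W_A ≥ n`, then `sHi = n ≤ L(k+1)`). [folklore] -/
theorem n_le_LB (k : ℕ) : (n : ℤ) ≤ (xLocPrm n ℓ h T (Qw n ℓ h) (L0B n ℓ h v T aW bL) (NB n ℓ h v T aW bL)).L k := by
  cases k with
  | zero =>
    rw [LocPrm.L_zero]
    show (n : ℤ) ≤ ((L0B n ℓ h v T aW bL : ℕ) : ℤ)
    have : n ≤ L0B n ℓ h v T aW bL := (n_le_WA n aW).trans (Nat.le_add_right _ _)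
    exact_mod_cast this
  | succ k => exact LocPrm.sHi_le_L_succ _ k

end Facts

/-! ## §3 The three joins -/

section Joins

variable {n ℓ : ℕ} {h v : ℤ} {T : ℕ} {aW bL : ℤ} (hn : 1 ≤ n) (hvn : |v| ≤ n) (hlay : 2 * ((n + h.natAbs : ℕ) : ℤ) ≤ (n : ℤ) * ℓ + 1)
  (hWn : n ≤ WA n aW) (heA : ((T : ℤ) + 2) * ((n + h.natAbs : ℕ) : ℤ) ≤ (n : ℤ) * ℓ + 1) (heAn : T ≤ n)
  (hWB : n * ℓ / shearUnit n h + 1 ≤ Qw n ℓ h) (hWx : n * ℓ / shearUnit n h + 1 ≤ qy n ℓ h v T aW bL)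
  (hWmy : (n + v).toNat ≤ Wmy n v) (hWpy : (n - v).toNat ≤ Wpy n v)


/-- **Join A → B**: the last core of the v-rounds lies in the first core of the u-rounds. [cite: KozmaNitzan2024, §4 Lemma 12 (pp. 23–25)] -/
theorem hjoinA (hsT : (T : ℤ) + 1 ≤ sA n ℓ h) :
    ((vLocPrmD n ℓ h v T (WA n aW) (L0A bL) (NA n ℓ h T bL)).scheduleN 1 0 (vLocPrmD_ok hn hvn hWn heA (L0A bL) (NA n ℓ h T bL))
        (vLocPrmD_dL hvn T (WA n aW) (L0A bL) (NA n ℓ h T bL))).core (NA n ℓ h T bL + 1) ⊆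
      ((xLocPrm n ℓ h T (Qw n ℓ h) (L0B n ℓ h v T aW bL) (NB n ℓ h v T aW bL)).scheduleN 0 0 (xLocPrm_ok heAn hWB _ _)).core 0 := by
  intro y hy
  rw [LocPrmD.mem_scheduleN_core_iff] at hy
  rw [LocPrm.mem_scheduleN_core_zero]
  simp only [Pi.zero_apply, sub_zero, oth_zero', oth_one'] at hy ⊢
  obtain ⟨h1, h0⟩ := hy
  have hL := LA_last_le (vLocPrmD_ok hn hvn hWn heA (L0A bL) (NA n ℓ h T bL)) hsT
  refine ⟨?_, ?_⟩
  · -- across: `W_A + (N_A+1)(T + |v|) = L0_B`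
    refine h0.trans (le_of_eq ?_)
    show ((WA n aW : ℕ) : ℤ) + ((NA n ℓ h T bL + 1 : ℕ) : ℤ) * ((T : ℕ) + |v|) = ((L0B n ℓ h v T aW bL : ℕ) : ℤ)
    simp only [L0B, Nat.cast_add, Nat.cast_mul, Nat.cast_one, Nat.cast_natAbs, Int.cast_abs, Int.cast_id]
  · -- along: `L_A(N_A+1) ≤ W_B`
    refine (h1.trans hL).trans (le_of_eq ?_)
    rfl

/-- **Join B → band**: the last core of the u-rounds lies in the first core of the windowed band, either axis. [cite: KozmaNitzan2024, §4 Lemma 12] -/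
theorem hjoin (hT : T + 1 ≤ n) (du : MDir) :
    ((xLocPrm n ℓ h T (Qw n ℓ h) (L0B n ℓ h v T aW bL) (NB n ℓ h v T aW bL)).scheduleN 0 0 (xLocPrm_ok heAn hWB _ _)).core (NB n ℓ h v T aW bL + 1) ⊆
      ((bandNw n ℓ h v T n NC (qy n ℓ h v T aW bL) NC (qy n ℓ h v T aW bL) (Wmy n v) (Wpy n v) du).scheduleN du.1 (sgOf_sign du) 0
        (bandNw_ok hn hvn hlay T n NC (qy n ℓ h v T aW bL) NC hWx hWmy hWpy du)
        (bandNw_eb n ℓ h v T n NC (qy n ℓ h v T aW bL) NC (qy n ℓ h v T aW bL) (Wmy n v) (Wpy n v) du)).core 0 := by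
  intro y hy
  rw [LocPrm.mem_scheduleN_core_iff] at hy
  simp only [Pi.zero_apply, sub_zero, oth_zero'] at hy
  obtain ⟨h0, h1⟩ := hy
  have hL := LB_last_le (xLocPrm_ok heAn hWB (L0B n ℓ h v T aW bL) (NB n ℓ h v T aW bL)) hT
  have hy0 : |y 0| ≤ n := h0.trans hL
  have hWk : (xLocPrm n ℓ h T (Qw n ℓ h) (L0B n ℓ h v T aW bL) (NB n ℓ h v T aW bL)).Wk (NB n ℓ h v T aW bL + 1) = (qy n ℓ h v T aW bL : ℕ) := by
    unfold LocPrm.Wk qy; push_cast; rfl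
  rw [hWk] at h1
  rw [RunPrm.scheduleN_core, RunPrm.mem_pcore_iff (sgOf_sign du)]
  simp only [Pi.zero_apply, sub_zero, RunPrm.InCore, RunPrm.aLo, RunPrm.aHi, RunPrm.bLo, RunPrm.bHi]
  push_cast
  simp only [zero_mul, zero_sub, zero_add, sub_zero, add_zero]
  have hσ1 : |sgOf du| = 1 := by rcases sgOf_sign du with hs | hs <;> simp [hs]
  by_cases hd : du.1 = 0
  · -- x-band: along `|y 0| ≤ n = q`, across `|y 1| ≤ q_y = window`
    simp only [bandNw, hd, if_true, oth_zero']
    have ha := abs_le.1 (show |sgOf du * y 0| ≤ n by rw [abs_mul, hσ1, one_mul]; exact hy0)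
    have hb := abs_le.1 (show |sgOf du * y 1| ≤ (qy n ℓ h v T aW bL : ℕ) by rw [abs_mul, hσ1, one_mul]; exact h1)
    exact ⟨ha.1, ha.2, hb.1, hb.2⟩
  · -- y′-band: along `|y 1| ≤ q_y`, across `−Wmy ≤ σ·y 0 ≤ Wpy`
    have hd1 : du.1 = 1 := by
      apply Fin.ext
      have h2 := du.1.isLt
      have h0 : du.1.val ≠ 0 := fun e => hd (Fin.ext e)
      rw [Fin.val_one]; omega
    have h10 : ¬ ((1 : Fin 2) = 0) := by decide
    simp only [bandNw, hd1, h10, if_false, oth_one', yPrmXw]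
    have ha := abs_le.1 (show |sgOf du * y 1| ≤ (qy n ℓ h v T aW bL : ℕ) by rw [abs_mul, hσ1, one_mul]; exact h1)
    have hb := abs_le.1 (show |sgOf du * y 0| ≤ n by rw [abs_mul, hσ1, one_mul]; exact hy0)
    have hm : (n : ℤ) ≤ ((Wmy n v : ℕ) : ℤ) := by exact_mod_cast (n_le_Wy n v).1
    have hp : (n : ℤ) ≤ ((Wpy n v : ℕ) : ℤ) := by exact_mod_cast (n_le_Wy n v).2
    exact ⟨ha.1, ha.2, by linarith [hb.1], by linarith [hb.2]⟩

/-- **The band's first core lies in the last region of the u-rounds** (`hreg`), either axis. [cite: KozmaNitzan2024, §4 Lemma 11 (p. 22)] -/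
theorem hreg (du : MDir) :
    ((bandNw n ℓ h v T n NC (qy n ℓ h v T aW bL) NC (qy n ℓ h v T aW bL) (Wmy n v) (Wpy n v) du).scheduleN du.1 (sgOf_sign du) 0
        (bandNw_ok hn hvn hlay T n NC (qy n ℓ h v T aW bL) NC hWx hWmy hWpy du)
        (bandNw_eb n ℓ h v T n NC (qy n ℓ h v T aW bL) NC (qy n ℓ h v T aW bL) (Wmy n v) (Wpy n v) du)).core 0 ⊆
      ((xLocPrm n ℓ h T (Qw n ℓ h) (L0B n ℓ h v T aW bL) (NB n ℓ h v T aW bL)).scheduleN 0 0 (xLocPrm_ok heAn hWB _ _)).region (NB n ℓ h v T aW bL) := by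
  intro y hy
  have hσ1 : |sgOf du| = 1 := by rcases sgOf_sign du with hs | hs <;> simp [hs]
  rw [RunPrm.scheduleN_core, RunPrm.mem_pcore_iff (sgOf_sign du)] at hy
  simp only [Pi.zero_apply, sub_zero, RunPrm.InCore, RunPrm.aLo, RunPrm.aHi, RunPrm.bLo, RunPrm.bHi] at hy
  push_cast at hy
  simp only [zero_mul, zero_sub, zero_add, sub_zero, add_zero] at hy
  rw [LocPrm.scheduleN_region, LocPrm.mem_pregion_iff]
  simp only [Pi.zero_apply, sub_zero, oth_zero', LocPrm.InRegion]
  have hLn : (n : ℤ) ≤ (xLocPrm n ℓ h T (Qw n ℓ h) (L0B n ℓ h v T aW bL) (NB n ℓ h v T aW bL)).L (NB n ℓ h v T aW bL) := n_le_LB _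
  have hWk : (xLocPrm n ℓ h T (Qw n ℓ h) (L0B n ℓ h v T aW bL) (NB n ℓ h v T aW bL)).Wk (NB n ℓ h v T aW bL) + T = (qy n ℓ h v T aW bL : ℕ) := by
    unfold LocPrm.Wk qy; push_cast; simp only [xLocPrm]; ring
  have he : ((xLocPrm n ℓ h T (Qw n ℓ h) (L0B n ℓ h v T aW bL) (NB n ℓ h v T aW bL)).e : ℤ) = T := rfl
  have hLa : ((xLocPrm n ℓ h T (Qw n ℓ h) (L0B n ℓ h v T aW bL) (NB n ℓ h v T aW bL)).La : ℤ) = n := rfl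
  have hLb : (0 : ℤ) ≤ (xLocPrm n ℓ h T (Qw n ℓ h) (L0B n ℓ h v T aW bL) (NB n ℓ h v T aW bL)).Lb := by positivity
  rw [he, hLa]
  have hn0 : (0 : ℤ) ≤ n := by positivity
  by_cases hd : du.1 = 0
  · simp only [bandNw, hd, if_true, oth_zero', xPrmWw] at hy
    obtain ⟨ha1, ha2, hb1, hb2⟩ := hy
    have ha : |y 0| ≤ n := by
      have := abs_le.2 ⟨ha1, ha2⟩; rwa [abs_mul, hσ1, one_mul] at this
    have hb : |y 1| ≤ (qy n ℓ h v T aW bL : ℕ) := by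
      have := abs_le.2 ⟨hb1, hb2⟩; rwa [abs_mul, hσ1, one_mul] at this
    exact ⟨by linarith, by rw [← hWk] at hb; linarith⟩
  · have hd1 : du.1 = 1 := by
      apply Fin.ext
      have h2 := du.1.isLt
      have h0 : du.1.val ≠ 0 := fun e => hd (Fin.ext e)
      rw [Fin.val_one]; omega
    have h10 : ¬ ((1 : Fin 2) = 0) := by decide
    simp only [bandNw, hd1, h10, if_false, oth_one', yPrmXw] at hy
    obtain ⟨ha1, ha2, hb1, hb2⟩ := hy
    have hm : ((Wmy n v : ℕ) : ℤ) ≤ n + |v| := by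
      unfold Wmy; push_cast; rw [Int.toNat_eq_max]; linarith [max_le (le_abs_self v) (abs_nonneg v)]
    have hp : ((Wpy n v : ℕ) : ℤ) ≤ n + |v| := by
      unfold Wpy; push_cast; rw [Int.toNat_eq_max]; linarith [max_le (neg_le_abs v) (abs_nonneg v)]
    have ha : |y 1| ≤ (qy n ℓ h v T aW bL : ℕ) := by
      have := abs_le.2 ⟨ha1, ha2⟩; rwa [abs_mul, hσ1, one_mul] at this
    have hb : |y 0| ≤ n + |v| := by
      have := abs_le.2 ⟨(neg_le_neg hm).trans hb1, hb2.trans hp⟩; rwa [abs_mul, hσ1, one_mul] at this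
    exact ⟨by linarith [hvn], by rw [← hWk] at ha; linarith⟩

/-- **The corridor fits the step budget** `nmaxN = 2000` once `N_A + N_B ≤ 1199` (the band takes `800`). [folklore] -/
theorem hlen (hAB : NA n ℓ h T bL + NB n ℓ h v T aW bL ≤ 1199) (du : MDir) :
    (vLocPrmD n ℓ h v T (WA n aW) (L0A bL) (NA n ℓ h T bL)).N + 1 +
        ((xLocPrm n ℓ h T (Qw n ℓ h) (L0B n ℓ h v T aW bL) (NB n ℓ h v T aW bL)).N + 1 +
          (bandNw n ℓ h v T n NC (qy n ℓ h v T aW bL) NC (qy n ℓ h v T aW bL) (Wmy n v) (Wpy n v) du).N) ≤ 2000 := by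
  have hN : (bandNw n ℓ h v T n NC (qy n ℓ h v T aW bL) NC (qy n ℓ h v T aW bL) (Wmy n v) (Wpy n v) du).N = NC := by
    unfold bandNw; split_ifs <;> rfl
  rw [hN]
  show NA n ℓ h T bL + 1 + (NB n ℓ h v T aW bL + 1 + 799) ≤ 2000
  omega

end Joins

end CorrRec

end Skelφ

end Summit.CriticalPhenomena.PercolationContinuityZ3.Theorems.Transplant

end
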